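import Literature.AlgebraicGeometry.ShimuraVarieties.UnitaryBallQuotientDatum
import Literature.NumberTheory.Automorphic.UnitaryGroupFrameSubform
import Mathlib.NumberTheory.NumberField.CMField
import HarnessLib

/-!
# The signature datum of the crux letters, distilled for the E-door: a `(1,1)`-frame at `ι₁` and definiteness off `ι₁`

Topic `AlgebraicGeometry/ShimuraVarieties`; namespace `Literature.AlgebraicGeometry.ShimuraVarieties.UnitaryCurve`.  THEOREMS ONLY (no `def`, no named fact,
no instance, no notation, no `sorry`).  Cell `hodgecm-mathlib` (D-0151), FLOOR 0, P6 «MOD programme», door (E) of `stub_RGD` — the POSITIVITY INPUT of the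
E-door (A-p17 (g27) MEMO `MEMO-positivity-gap` 6423536d, desk heir F0P6a-plan (g3) «=» 23:36:51Z: «distilled 1-binder form preferred»).
`--supports stmt-HodgeConjecture-24832`, count-neutral; HC_CM is proved only modulo the printed citations until rung 0 closes.

THE POINT.  The crux letter `CorD9OnMShape` (`Lines/D6CmCurveBody.lean` :629–:642) carries Liu's signature datum of the hermitian plane `(F², J⋆)` in the
shape `formCongr c g⋆ (t • J⋆) = diagonal dJ` (`t ∈ F` with `ι₁ t` a positive real, `g⋆ ∈ GL₂(F)`) together with
`hsig : (∃ T⋆, formCongr conj T⋆ ((diagonal dJ)^{ι₁}) = diagonal (1, −1)) ∧ ∀ τ′ off ι₁, ((diagonal dJ)^{τ′}).PosDef`; the letters below it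
(`CorD9OnMOp`, MOD-PWCORE, RGD∕PEL, `stub_E123`) dropped it, while the E2 chart (★ A3 `auxComplexStructureV_mem_C0pm`, ★ junction
`exists_siegelChartGS_auxComplexStructureV(_mover)`) consumes a `(1,1)`-frame `Tᴴ J⋆^{ι₁} T = signatureMatrix 1` and definiteness of `J⋆^σ` off `ι₁`.
This file DISTILS the former into the latter — the 1-binder form
`(∃ T Ti, Tᴴ J⋆^{ι₁} T = signatureMatrix 1 ∧ T Ti = 1) ∧ ∀ σ, mk σ ≠ mk ι₁ → (J⋆^σ).PosDef ∨ (−J⋆^σ).PosDef`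
(congruence transport, ★ `Matrix.PosDef.conjTranspose_mul_mul_same`; the sign at `σ` is the sign of the real number `σ t`).

## References
* [Liu2021] Y. Liu, *Fourier–Jacobi cycles and arithmetic relative trace formula* (2021), §C.1 (the hermitian plane `V⋆` of signature `(1,1)` at one place).
* [RapoportSmithlingZhang2020Diagonal] M. Rapoport, B. Smithling, W. Zhang (2020), §3 p. 8 (signature `(1, n−1)` at `φ₀`, `(0, n)` elsewhere).
* [Rogawski1990] J. Rogawski, *Automorphic representations of unitary groups in three variables* (1990), §14.1 p. 232 (congruence of hermitian forms).
-/

set_option autoImplicit false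

noncomputable section

open Matrix NumberField
open scoped ComplexOrder ComplexConjugate

namespace Literature.AlgebraicGeometry.ShimuraVarieties

namespace UnitaryCurve

open Literature.NumberTheory.Automorphic Literature.NumberTheory.Automorphic.UnitaryGroup

variable {F : Type} [Field F] [NumberField F] [IsCMField F]

/-- `0 < c` in `ℂ` for a positive real `c`. [folklore] -/
private theorem complex_pos_of_re_pos_im_zero' {c : ℂ} (hc : 0 < c.re) (hc' : c.im = 0) : (0 : ℂ) < c :=
  Complex.lt_def.2 ⟨by simpa using hc, by simp [hc']⟩

/-- `signatureMatrix 1 = diag(1, −1)` (plumbing). [folklore] -/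
private theorem diagonal_one_neg_one_eq_signatureMatrix_one : Matrix.diagonal ![(1 : ℂ), -1] = signatureMatrix 1 := by
  rw [signatureMatrix]
  congr 1
  funext i
  fin_cases i <;> simp [Fin.last]

/-- **Congruence read at a complex embedding**: `σ (c(g)ᵀ (t • J) g) = (g^σ)ᴴ (σ t • J^σ) g^σ` (`σ ∘ c = conj ∘ σ` on a CM field).
[cite: Rogawski1990, §14.1 p. 232] -/
theorem map_formCongr_complexConj_smul (σ : F →+* ℂ) (g : GL (Fin 2) F) (t : F) (J : Matrix (Fin 2) (Fin 2) F) :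
    (formCongr ((IsCMField.complexConj F : F ≃ₐ[↥(maximalRealSubfield F)] F) : F →+* F) g (t • J)).map σ =
      ((g : Matrix (Fin 2) (Fin 2) F).map σ)ᴴ * (σ t • J.map σ) * (g : Matrix (Fin 2) (Fin 2) F).map σ := by
  have hc : ∀ x, σ (((IsCMField.complexConj F : F ≃ₐ[↥(maximalRealSubfield F)] F) : F →+* F) x) = starRingEnd ℂ (σ x) :=
    fun x => IsCMField.complexEmbedding_complexConj F σ x
  simp only [formCongr]
  rw [Matrix.map_mul, Matrix.map_mul, Literature.LinearAlgebra.Matrix.map_transpose_map_eq_conjTranspose σ _ hc,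
    Matrix.map_smul' _ _ _ (map_mul σ)]

omit [NumberField F] [IsCMField F] in
/-- **Definiteness transports along a congruence and a real scalar**: if `(g^σ)ᴴ (σ t • J^σ) g^σ` is positive definite for an invertible `g` and
`σ t` is a NON-ZERO REAL, then `J^σ` is definite — positive if `σ t > 0`, negative if `σ t < 0`. [cite: Rogawski1990, §14.1 p. 232] -/
theorem posDef_or_neg_posDef_of_congr_smul (σ : F →+* ℂ) (g : GL (Fin 2) F) {t : F} (htim : (σ t).im = 0) (ht0 : σ t ≠ 0)
    {J : Matrix (Fin 2) (Fin 2) F}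
    (hPD : (((g : Matrix (Fin 2) (Fin 2) F).map σ)ᴴ * (σ t • J.map σ) * (g : Matrix (Fin 2) (Fin 2) F).map σ).PosDef) :
    (J.map σ).PosDef ∨ (-(J.map σ)).PosDef := by
  set G : Matrix (Fin 2) (Fin 2) ℂ := (g : Matrix (Fin 2) (Fin 2) F).map σ with hG
  set Gi : Matrix (Fin 2) (Fin 2) ℂ := ((g⁻¹ : GL (Fin 2) F) : Matrix (Fin 2) (Fin 2) F).map σ with hGi
  have hGGi : G * Gi = 1 := by
    rw [hG, hGi, ← Matrix.map_mul, ← Units.val_mul, mul_inv_cancel, Units.val_one, Matrix.map_one σ (map_zero σ) (map_one σ)]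
  have hGiG : Gi * G = 1 := by
    rw [hG, hGi, ← Matrix.map_mul, ← Units.val_mul, inv_mul_cancel, Units.val_one, Matrix.map_one σ (map_zero σ) (map_one σ)]
  -- `σ t • J^σ` is positive definite
  have hP : (σ t • J.map σ).PosDef := by
    have key : Giᴴ * (Gᴴ * (σ t • J.map σ) * G) * Gi = σ t • J.map σ := by
      calc Giᴴ * (Gᴴ * (σ t • J.map σ) * G) * Gi = (G * Gi)ᴴ * (σ t • J.map σ) * (G * Gi) := by
            rw [Matrix.conjTranspose_mul]; simp only [Matrix.mul_assoc]
        _ = σ t • J.map σ := by rw [hGGi, Matrix.conjTranspose_one, Matrix.one_mul, Matrix.mul_one]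
    rw [← key]
    exact hPD.conjTranspose_mul_mul_same (Matrix.mulVec_injective_iff_isUnit.mpr ⟨⟨Gi, G, hGiG, hGGi⟩, rfl⟩)
  -- `J^σ` is hermitian
  have hreal : σ t = ((σ t).re : ℂ) := (Complex.conj_eq_iff_re.mp (Complex.conj_eq_iff_im.mpr htim)).symm
  have hH : (J.map σ).IsHermitian := by
    have h1 : (σ t • J.map σ)ᴴ = σ t • J.map σ := hP.isHermitian
    rw [Matrix.conjTranspose_smul, Complex.star_def, Complex.conj_eq_iff_im.mpr htim] at h1
    exact smul_right_injective (Matrix (Fin 2) (Fin 2) ℂ) ht0 h1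
  have hre0 : (σ t).re ≠ 0 := fun h => ht0 (by rw [hreal, h, Complex.ofReal_zero])
  rcases lt_or_gt_of_ne hre0 with hneg | hpos
  · -- `σ t < 0`: `-J^σ` is positive definite
    refine Or.inr (Matrix.PosDef.of_dotProduct_mulVec_pos hH.neg fun x hx => ?_)
    have hq := hP.dotProduct_mulVec_pos hx
    rw [Matrix.smul_mulVec, dotProduct_smul, smul_eq_mul] at hq
    have hinv : (0 : ℂ) < -(σ t)⁻¹ := by
      rw [hreal, ← Complex.ofReal_inv, ← Complex.ofReal_neg]
      exact complex_pos_of_re_pos_im_zero' (by simpa using inv_lt_zero.mpr hneg) (Complex.ofReal_im _)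
    have h := mul_pos hinv hq
    rw [neg_mul, ← mul_assoc, inv_mul_cancel₀ ht0, one_mul] at h
    rwa [Matrix.neg_mulVec, dotProduct_neg]
  · -- `σ t > 0`: `J^σ` is positive definite
    refine Or.inl (Matrix.PosDef.of_dotProduct_mulVec_pos hH fun x hx => ?_)
    have hq := hP.dotProduct_mulVec_pos hx
    rw [Matrix.smul_mulVec, dotProduct_smul, smul_eq_mul] at hq
    have hinv : (0 : ℂ) < (σ t)⁻¹ := by
      rw [hreal, ← Complex.ofReal_inv]
      exact complex_pos_of_re_pos_im_zero' (by simpa using inv_pos.mpr hpos) (Complex.ofReal_im _)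
    have h := mul_pos hinv hq
    rwa [← mul_assoc, inv_mul_cancel₀ ht0, one_mul] at h

/-- **THE DISTILLED SIGNATURE BINDER** (the E-door's positivity input, read off the crux letter `CorD9OnMShape`'s datum
`(t, hτt, hτt′, g⋆, dJ, hg, hsig)`): a `(1,1)`-FRAME `T` for `J⋆^{ι₁}` with a right inverse (`Tᴴ J⋆^{ι₁} T = signatureMatrix 1`, `T Ti = 1` — the
`(hT, hTi)` of ★ `exists_siegelChartGS_auxComplexStructureV(_mover)`), and DEFINITENESS OF `J⋆^σ` AT EVERY PLACE OFF `ι₁` (positive where `σ t > 0`,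
negative where `σ t < 0`; `σ t` is a non-zero real since `ι₁ t` is and `t` is then `c`-fixed).
[cite: Liu2021, §C.1 (the hermitian plane `V⋆`)] [cite: RapoportSmithlingZhang2020Diagonal, §3 p. 8] [cite: Rogawski1990, §14.1 p. 232] -/
theorem exists_frame_and_definite_of_formCongr_diagonal (ι₁ : F →+* ℂ) (Jstar : Matrix (Fin 2) (Fin 2) F)
    {t : F} (hτt : 0 < (ι₁ t).re) (hτt' : (ι₁ t).im = 0) {gstar : GL (Fin 2) F} {dJ : Fin 2 → F}
    (hg : formCongr ((IsCMField.complexConj F : F ≃ₐ[↥(maximalRealSubfield F)] F) : F →+* F) gstar (t • Jstar) = Matrix.diagonal dJ)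
    (hsig : (∃ Tstar : GL (Fin 2) ℂ,
        formCongr (starRingEnd ℂ) Tstar ((Matrix.diagonal dJ).map ι₁) = Matrix.diagonal ![(1 : ℂ), -1]) ∧
      ∀ τ' : F →+* ℂ, InfinitePlace.mk τ' ≠ InfinitePlace.mk ι₁ → ((Matrix.diagonal dJ).map τ').PosDef) :
    (∃ T Ti : Matrix (Fin 2) (Fin 2) ℂ, Tᴴ * Jstar.map ι₁ * T = signatureMatrix 1 ∧ T * Ti = 1) ∧
      ∀ σ : F →+* ℂ, InfinitePlace.mk σ ≠ InfinitePlace.mk ι₁ → (Jstar.map σ).PosDef ∨ (-(Jstar.map σ)).PosDef := by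
  have hc : ∀ (σ : F →+* ℂ) (x : F),
      σ (((IsCMField.complexConj F : F ≃ₐ[↥(maximalRealSubfield F)] F) : F →+* F) x) = starRingEnd ℂ (σ x) :=
    fun σ x => IsCMField.complexEmbedding_complexConj F σ x
  -- `hg` read at every complex embedding
  have hgσ : ∀ σ : F →+* ℂ,
      ((gstar : Matrix (Fin 2) (Fin 2) F).map σ)ᴴ * (σ t • Jstar.map σ) * (gstar : Matrix (Fin 2) (Fin 2) F).map σ =
        (Matrix.diagonal dJ).map σ := by
    intro σ
    rw [← map_formCongr_complexConj_smul, hg]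
  -- `t` is `c`-fixed, so `σ t` is a non-zero real at every `σ`
  have hct : ((IsCMField.complexConj F : F ≃ₐ[↥(maximalRealSubfield F)] F) : F →+* F) t = t :=
    ι₁.injective (by rw [hc ι₁ t]; exact Complex.conj_eq_iff_im.mpr hτt')
  have htim : ∀ σ : F →+* ℂ, (σ t).im = 0 := fun σ => by
    have h := hc σ t
    rw [hct] at h
    exact Complex.conj_eq_iff_im.mp h.symm
  have ht0 : t ≠ 0 := by
    rintro rfl
    rw [map_zero, Complex.zero_re] at hτt
    exact lt_irrefl _ hτt
  have hσt0 : ∀ σ : F →+* ℂ, σ t ≠ 0 := fun σ h => ht0 (σ.injective (by rw [h, map_zero]))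
  refine ⟨?_, fun σ hσ => posDef_or_neg_posDef_of_congr_smul σ gstar (htim σ) (hσt0 σ) (by rw [hgσ σ]; exact hsig.2 σ hσ)⟩
  -- the `(1,1)`-frame at `ι₁`
  obtain ⟨⟨Tstar, hTstar⟩, -⟩ := hsig
  set G : Matrix (Fin 2) (Fin 2) ℂ := (gstar : Matrix (Fin 2) (Fin 2) F).map ι₁ with hG
  set Gi : Matrix (Fin 2) (Fin 2) ℂ := ((gstar⁻¹ : GL (Fin 2) F) : Matrix (Fin 2) (Fin 2) F).map ι₁ with hGi
  have hGGi : G * Gi = 1 := by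
    rw [hG, hGi, ← Matrix.map_mul, ← Units.val_mul, mul_inv_cancel, Units.val_one, Matrix.map_one ι₁ (map_zero ι₁) (map_one ι₁)]
  have hTT : (Tstar : Matrix (Fin 2) (Fin 2) ℂ) * ((Tstar⁻¹ : GL (Fin 2) ℂ) : Matrix (Fin 2) (Fin 2) ℂ) = 1 := by
    rw [← Units.val_mul, mul_inv_cancel, Units.val_one]
  -- `T⋆ᴴ (diag dJ)^{ι₁} T⋆ = diag(1,-1)`
  have hTs : (Tstar : Matrix (Fin 2) (Fin 2) ℂ)ᴴ * (Matrix.diagonal dJ).map ι₁ * (Tstar : Matrix (Fin 2) (Fin 2) ℂ) = signatureMatrix 1 := by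
    rw [← diagonal_one_neg_one_eq_signatureMatrix_one, ← hTstar, formCongr, ← Matrix.transpose_map]
    rfl
  -- the real square root of `ι₁ t`
  set r : ℝ := (ι₁ t).re with hr
  have hreal : ι₁ t = (r : ℂ) := (Complex.conj_eq_iff_re.mp (Complex.conj_eq_iff_im.mpr hτt')).symm
  set s : ℝ := Real.sqrt r with hs
  have hs0 : s ≠ 0 := (Real.sqrt_pos.mpr hτt).ne'
  have hss : (s : ℂ) * s = ι₁ t := by rw [hreal, ← Complex.ofReal_mul, Real.mul_self_sqrt hτt.le]
  refine ⟨(s : ℂ) • (G * (Tstar : Matrix (Fin 2) (Fin 2) ℂ)),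
    ((s : ℂ)⁻¹) • (((Tstar⁻¹ : GL (Fin 2) ℂ) : Matrix (Fin 2) (Fin 2) ℂ) * Gi), ?_, ?_⟩
  · -- `Tᴴ J T = s̄ s · T⋆ᴴ (Gᴴ J G) T⋆ = T⋆ᴴ (Gᴴ (ι₁ t • J) G) T⋆ = signatureMatrix 1`
    have h1 : ((s : ℂ) • (G * (Tstar : Matrix (Fin 2) (Fin 2) ℂ)))ᴴ * Jstar.map ι₁ * ((s : ℂ) • (G * (Tstar : Matrix (Fin 2) (Fin 2) ℂ))) =
        ((s : ℂ) * s) • ((Tstar : Matrix (Fin 2) (Fin 2) ℂ)ᴴ * (Gᴴ * Jstar.map ι₁ * G) * (Tstar : Matrix (Fin 2) (Fin 2) ℂ)) := by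
      rw [Matrix.conjTranspose_smul, Complex.star_def, Complex.conj_ofReal, Matrix.conjTranspose_mul]
      simp only [Matrix.smul_mul, Matrix.mul_smul, smul_smul, Matrix.mul_assoc]
    have h2 : (Tstar : Matrix (Fin 2) (Fin 2) ℂ)ᴴ * (Gᴴ * (ι₁ t • Jstar.map ι₁) * G) * (Tstar : Matrix (Fin 2) (Fin 2) ℂ) =
        ι₁ t • ((Tstar : Matrix (Fin 2) (Fin 2) ℂ)ᴴ * (Gᴴ * Jstar.map ι₁ * G) * (Tstar : Matrix (Fin 2) (Fin 2) ℂ)) := by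
      simp only [Matrix.smul_mul, Matrix.mul_smul]
    rw [h1, hss, ← h2, hgσ ι₁, hTs]
  · -- `T Ti = 1`
    rw [Matrix.smul_mul, Matrix.mul_smul, smul_smul, mul_inv_cancel₀ (Complex.ofReal_ne_zero.mpr hs0), one_smul]
    calc G * (Tstar : Matrix (Fin 2) (Fin 2) ℂ) * (((Tstar⁻¹ : GL (Fin 2) ℂ) : Matrix (Fin 2) (Fin 2) ℂ) * Gi)
        = G * ((Tstar : Matrix (Fin 2) (Fin 2) ℂ) * ((Tstar⁻¹ : GL (Fin 2) ℂ) : Matrix (Fin 2) (Fin 2) ℂ)) * Gi := by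
          simp only [Matrix.mul_assoc]
      _ = 1 := by rw [hTT, Matrix.mul_one, hGGi]

/-- **THE SIGNATURE DATUM IN `t`-FORM** (the E-line ED. 2 letter shape `SigDatum F ι₁ Jstar` of `stub_SIG`, A-p01 (g26) cand v3 :355–:359, M-42 (a)):
from `CorD9OnMShape`'s datum, the SAME `t` works — `ι₁ t` is a positive real, `(g⋆^{ι₁} T⋆)ᴴ (t • J⋆)^{ι₁} (g⋆^{ι₁} T⋆) = signatureMatrix 1` with a frame in
`GL₂(ℂ)`, and `(t • J⋆)^σ` is POSITIVE definite at every `σ` off `ι₁` (congruence transport of `hsig.2`; no sign split, no square root).  This is the term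
`corD9OnMShape_of_op` hands to a `CorD9OnMOpSig`-shaped letter (exit E2 of the SIG-AUDIT). [cite: Liu2021, §C.1] [cite: Rogawski1990, §14.1 p. 232] -/
theorem exists_sigDatum_of_formCongr_diagonal (ι₁ : F →+* ℂ) (Jstar : Matrix (Fin 2) (Fin 2) F)
    {t : F} (hτt : 0 < (ι₁ t).re) (hτt' : (ι₁ t).im = 0) {gstar : GL (Fin 2) F} {dJ : Fin 2 → F}
    (hg : formCongr ((IsCMField.complexConj F : F ≃ₐ[↥(maximalRealSubfield F)] F) : F →+* F) gstar (t • Jstar) = Matrix.diagonal dJ)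
    (hsig : (∃ Tstar : GL (Fin 2) ℂ,
        formCongr (starRingEnd ℂ) Tstar ((Matrix.diagonal dJ).map ι₁) = Matrix.diagonal ![(1 : ℂ), -1]) ∧
      ∀ τ' : F →+* ℂ, InfinitePlace.mk τ' ≠ InfinitePlace.mk ι₁ → ((Matrix.diagonal dJ).map τ').PosDef) :
    ∃ t' : F, 0 < (ι₁ t').re ∧ (ι₁ t').im = 0 ∧
      (∃ T : GL (Fin 2) ℂ, ((T : GL (Fin 2) ℂ) : Matrix (Fin 2) (Fin 2) ℂ)ᴴ * (t' • Jstar).map ι₁ * (T : Matrix (Fin 2) (Fin 2) ℂ) =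
        signatureMatrix 1) ∧
      ∀ σ : F →+* ℂ, InfinitePlace.mk σ ≠ InfinitePlace.mk ι₁ → ((t' • Jstar).map σ).PosDef := by
  -- `hg` read at every complex embedding: `(g⋆^σ)ᴴ (t • J⋆)^σ g⋆^σ = (diag dJ)^σ`
  have hgσ : ∀ σ : F →+* ℂ,
      ((gstar : Matrix (Fin 2) (Fin 2) F).map σ)ᴴ * (t • Jstar).map σ * (gstar : Matrix (Fin 2) (Fin 2) F).map σ =
        (Matrix.diagonal dJ).map σ := by
    intro σ
    rw [Matrix.map_smul' _ _ _ (map_mul σ), ← map_formCongr_complexConj_smul, hg]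
  refine ⟨t, hτt, hτt', ?_, fun σ hσ => ?_⟩
  · obtain ⟨⟨Tstar, hTstar⟩, -⟩ := hsig
    have hTs : (Tstar : Matrix (Fin 2) (Fin 2) ℂ)ᴴ * (Matrix.diagonal dJ).map ι₁ * (Tstar : Matrix (Fin 2) (Fin 2) ℂ) = signatureMatrix 1 := by
      rw [← diagonal_one_neg_one_eq_signatureMatrix_one, ← hTstar, formCongr, ← Matrix.transpose_map]
      rfl
    refine ⟨Matrix.GeneralLinearGroup.map ι₁ gstar * Tstar, ?_⟩
    rw [Units.val_mul, Matrix.conjTranspose_mul]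
    change (Tstar : Matrix (Fin 2) (Fin 2) ℂ)ᴴ * ((gstar : Matrix (Fin 2) (Fin 2) F).map ι₁)ᴴ * (t • Jstar).map ι₁ *
        ((gstar : Matrix (Fin 2) (Fin 2) F).map ι₁ * (Tstar : Matrix (Fin 2) (Fin 2) ℂ)) = signatureMatrix 1
    rw [← hTs, ← hgσ ι₁]
    simp only [Matrix.mul_assoc]
  · -- positive definiteness transports along the congruence by the invertible `g⋆^σ`
    set G : Matrix (Fin 2) (Fin 2) ℂ := (gstar : Matrix (Fin 2) (Fin 2) F).map σ with hG
    set Gi : Matrix (Fin 2) (Fin 2) ℂ := ((gstar⁻¹ : GL (Fin 2) F) : Matrix (Fin 2) (Fin 2) F).map σ with hGi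
    have hGGi : G * Gi = 1 := by
      rw [hG, hGi, ← Matrix.map_mul, ← Units.val_mul, mul_inv_cancel, Units.val_one, Matrix.map_one σ (map_zero σ) (map_one σ)]
    have hGiG : Gi * G = 1 := by
      rw [hG, hGi, ← Matrix.map_mul, ← Units.val_mul, inv_mul_cancel, Units.val_one, Matrix.map_one σ (map_zero σ) (map_one σ)]
    have key : Giᴴ * (Gᴴ * (t • Jstar).map σ * G) * Gi = (t • Jstar).map σ := by
      calc Giᴴ * (Gᴴ * (t • Jstar).map σ * G) * Gi = (G * Gi)ᴴ * (t • Jstar).map σ * (G * Gi) := by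
            rw [Matrix.conjTranspose_mul]; simp only [Matrix.mul_assoc]
        _ = (t • Jstar).map σ := by rw [hGGi, Matrix.conjTranspose_one, Matrix.one_mul, Matrix.mul_one]
    rw [← key, hgσ σ]
    exact (hsig.2 σ hσ).conjTranspose_mul_mul_same (Matrix.mulVec_injective_iff_isUnit.mpr ⟨⟨Gi, G, hGiG, hGGi⟩, rfl⟩)

end UnitaryCurve

end Literature.AlgebraicGeometry.ShimuraVarieties

end
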